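/-
Copyright: cell `pub-ymgap` (HUMAN RULING D-0062), Track A of `YM-PLAN.md`, DAG node N20 (= NE7b); R134 seat `pub-ymgap-dag-n20-d`
(strategy s3 «alternative currency», generation 7), module 12.  Released under the licence of the surrounding project.
-/
import Summits.QuantumFields.YangMills.Theorems.BalabanUVNodesN20ByValueLadder
import HarnessLib

/-!
# YM-DAG node N20 (= NE7b), strategy s3, THE FOURTH CURRENCY «BY VALUE» (module 12): THE MULTISCALE TILT — the exponential tilts of
# large-field carriers of Bałaban's iterated block averages `Ū^k` at ALL levels `k ≤ K` AT ONCE are dominated, pointwise, by ONE level-0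
# plaquette-energy carrier (telescoping the one-step domination letter down the averaging tower), whence the JOINT multiscale exponential
# plaquette moment under the level-0 lattice Yang–Mills state — the input of module 13's product law WITHOUT the root

Track A of `YM-PLAN.md` (cell `pub-ymgap`, HUMAN RULING D-0062), node **N20** = spine estimate NE7b (`T4WeightBudget.RelWeightBound` — the cell
`pub-balaban`'s OWN estimate, NOT PRINTED in [Bałaban 1983–89], NOT PROVED).  Seat `pub-ymgap-dag-n20-d` (R134, s3), generation 7, module 12 (after
the fourth-currency package, modules 1–11: p496513 · p497227 · p498565 · p500598 · p501576 · p502557 · p504356 · p506747 · p508842 · p509498 ·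
p510010).  Kernel theorems only: 0 `def`, 0 `sorry`, standard axioms; COUNT-NEUTRAL (`--supports` K3⁗ `SpineGivenEndpointR13Sep`,
stmt-QuantumFields-20292, `--as helper`).  Restate-immune (no statement of record is touched).

THE POINT.  Module 11 bounded the JOINT coarse large-field event of finitely many pinned levels `J` by INTERSECTING one-level Peierls bounds (an
intersection is at most the geometric mean of its members), which costs the `1∕#J`-th ROOT of every Peierls factor — in tilt language, the tilt of each
pinned level divided by the number of pinned levels.  The way out: do not intersect EVENTS, transport TILTS.  Generation 3's one-step SET letter
`N20LCSAvgExpMoment.sum_one_sub_reTr_plaqHol_avgFun_le` (`Σ_{p′∈Q}(1 − reTr Ū(∂p′)) ≤ A·M·Σ_{q∈⋃_{p′∈Q}R(p′)}(1 − reTr U(∂q))`, `A`, `M` functions of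
`N`, `L`, `d` only) pushes the tilt of the top level one level down, where it is MERGED with that level's own tilt (`t′_K = t_K + A·M·t_{K+1}` on the
region `Y_K ∪ ⋃_{p′∈Y_{K+1}}R(p′)`); telescoping to level `0`, the whole multiscale tilt is dominated by ONE level-0 plaquette-energy carrier with tilt
`Σ_{k≤K}(A·M)^k·t_k` on a region of `≤ Σ_{k≤K} M^k·#Y_k` plaquettes.  Under the BUDGET `Σ_{k≤K}(A·M)^k·t_k ≤ 1∕12`, n20-c's rung 0
(`N20LCSAtRecordLevelZero.localExpMoment_gibbsMeasure`, the chessboard bound of the Wilson–Gibbs state, uniform in the volume and in `β ≥ 4N`) applies ONCE: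
* §1 ★★ **`sum_levels_tilt_le_levelZero`** (POINTWISE TELESCOPING DOMINATION, any dimension, any `SU(N)`, standing range `K ≤ m + K_P`): for every
  level-indexed family `Y_k ⊆ Plaq P k` there is ONE level-0 region `Z`, `#Z ≤ Σ_{k≤K} M^k·#Y_k`, with
  `Σ_{k≤K} t_k·Σ_{p∈Y_k}(1 − reTr Ū^k(∂p)) ≤ (Σ_{k≤K}(A·M)^k·t_k)·Σ_{q∈Z}(1 − reTr U(∂q))` for ALL tilts `t ≥ 0` and ALL level-0 fields `U`.
* §2 `measurable_levelsTilt`, `levelsTilt_mem_Icc`, `integrable_exp_levelsTilt` (the multiscale tilt functional is measurable, with values in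
  `[0, 2Σ_k t_k #Y_k]`, its exponential integrable under the level-0 state); ★★ **`jointExpMoment_levels`** (THE JOINT MULTISCALE EXPONENTIAL PLAQUETTE
  MOMENT, `d = 4`): there are `G > 0`, `V ≥ 1`, `C ≥ 0` (functions of `N`, `L`: `G = A·M`, `V = M`, `C` = the rung-0 constant) with
  `∫ exp(β·Σ_{k≤K} t_k Σ_{p∈Y_k}(1 − reTr Ū^k(∂p))) dμ_β ≤ exp(C·(Σ_k G^k t_k)·(Σ_k V^k #Y_k))` for every `β ≥ 4N`, every family `Y` and every
  tilt `t ≥ 0` in the budget `Σ_{k≤K} G^k·t_k ≤ 1∕12` — module 8's two-level joint moment (Cauchy–Schwarz, halved tilts) for ANY set of levels, no halving.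
WHAT THIS SHOWS (honest).  The product STRUCTURE of the multiscale cells-Peierls bound (MSP) displayed in module 11 §3 is ELEMENTARY by value (module 13
draws it): `exp` is multiplicative and it is the tilts, not the events, that are transported — generation 6's caution «a coarse large plaquette does not
force fine plaquettes above threshold» is true and is not used (no fine plaquette is ever claimed large).  The located wall of NE7b in the fourth currency
is therefore EXACTLY the LEVEL-UNIFORMITY of the letters (`G`, `V` growing geometrically here: the crude domination letter is a worst-case bound with no
cancellation inside the block averages) — Bałaban's inductive small-field analysis, print's KIND [Balaban1989LargeFieldII] (1.79) p. 383 — and NOT a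
statement about independence of large-field events across scales.

HONEST FRAMING.  Count-neutral kernel theorems with LETTER-BASED, LEVEL-DEPENDENT constants; nothing is uniform along a renewal chain.  Nothing of Bałaban's
is asserted; NE7b NOT PRINTED ∕ NOT PROVED; the (α)-instance 0∕1; N20 NOT discharged (typed 28∕28, discharged count untouched); one finite four-torus
programme at fixed `ε` — NOT ℝ⁴, NOT infinite volume, NOT OS, NOT a mass gap, NOT Clay.  References (LOCATORS only; no decl carries a cite tag):
T. Bałaban, CMP **98** (1985) 17–51 [Balaban1985Averaging] (Prop. 1 (51) p. 26); CMP **109** (1987) 249–301 [Balaban1987RG1] ((0.4), (0.11) p. 253);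
CMP **122** (1989) 175–202 [Balaban1989LargeFieldI] ((0.1) p. 175, (0.3)–(0.5) pp. 176–177); CMP **122** (1989) 355–392 [Balaban1989LargeFieldII]
((1.79) p. 383).
-/

set_option autoImplicit false

noncomputable section

open scoped BigOperators Matrix.Norms.L2Operator
open MeasureTheory
open Literature.MathematicalPhysics.QuantumFieldTheory.Balaban1983to89
open T4Continuum T4ReflectionCone BlockAveraging ExpMeanLog
open Summit.QuantumFields.YangMills.BalabanUVNodes.N20LCSAtRecordLevelZero (localExpMoment_gibbsMeasure)
open Summit.QuantumFields.YangMills.BalabanUVNodes.N20LCSAvgExpMoment (sum_one_sub_reTr_plaqHol_avgFun_le)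
open Summit.QuantumFields.YangMills.BalabanUVNodes.N20LCSAvgDominationRegion (boxRegion card_boxRegion_le)
open Summit.QuantumFields.YangMills.BalabanUVNodes.N20LCSPushforward (card_biUnion_le_mul)
open Summit.QuantumFields.YangMills.BalabanUVNodes.N20ByValueLadder (measurable_iterBlockAvg integrable_exp_plaqSum_iter)

namespace Summit.QuantumFields.YangMills.BalabanUVNodes.N20ByValueMultiscaleTilt

/-! ## §1 Pointwise telescoping domination: all tilted levels down to one level-0 carrier -/

section Domination

variable {n : Type*} [Fintype n] [DecidableEq n] [Nonempty n] {P : Params}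

/-- ★★ **POINTWISE TELESCOPING DOMINATION** (any dimension, `SU(N)` with `N = |n|`, standing range `K ≤ m + K_P`; `α > 0` under the guard
`(((d+2)L)²∕4)·√(2Nα) < δ_N`; letters `A = 2N·(L² + 6((d+2)L)²)² + 2∕α`, `M = (2((d+3)L+2)+1)^d·d²`).  For every level-indexed family of finite
plaquette sets `Y_k ⊆ Plaq P k` there is ONE finite set `Z` of level-0 plaquettes with `#Z ≤ Σ_{k≤K} M^k·#Y_k` such that for ALL tilts `t ≥ 0` and
ALL level-0 fields `U`,
  `Σ_{k≤K} t_k·Σ_{p∈Y_k}(1 − reTr Ū^k(∂p)) ≤ (Σ_{k≤K} (A·M)^k·t_k)·Σ_{q∈Z}(1 − reTr U(∂q))`,  `Ū^k = Averaging.iter (fun j => blockAvg expMeanLogSU) k U`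
(induction on `K`: the top level is pushed one level down by the summed letter `sum_one_sub_reTr_plaqHol_avgFun_le` — `Ū^{K+1} = avgFun(Ū^K)` — and
merged into level `K` with tilt `t_K + A·M·t_{K+1}` on the region `Y_K ∪ ⋃_{p′∈Y_{K+1}} boxRegion(p′)`).
[cite: Balaban1985Averaging, Prop. 1 (51) p.26; Balaban1987RG1, (0.4), (0.11) p.253] -/
theorem sum_levels_tilt_le_levelZero {α : ℝ} (hα : 0 < α)
    (hguard : ((((P.d + 2) * P.L : ℕ) : ℝ) ^ 2 / 4) * Real.sqrt (2 * (Fintype.card n : ℝ) * α) < deltaSU n) :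
    ∀ (K : ℕ), K ≤ P.m + P.K → ∀ (Y : (k : ℕ) → Finset (Plaq P k)),
      ∃ Z : Finset (Plaq P 0),
        (Z.card : ℝ) ≤ ∑ k ∈ Finset.range (K + 1),
            (((2 * ((P.d + 3) * P.L + 2) + 1) ^ P.d * P.d ^ 2 : ℕ) : ℝ) ^ k * (Y k).card ∧
        ∀ (t : ℕ → ℝ), (∀ k, 0 ≤ t k) → ∀ (U : GaugeField P 0 (Matrix.specialUnitaryGroup n ℂ)),
          ∑ k ∈ Finset.range (K + 1), t k * ∑ p ∈ Y k, (1 - reTr (GaugeField.plaqHol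
              (Averaging.iter (fun _ => blockAvg (expMeanLogSU (n := n))) k U) p)) ≤
            (∑ k ∈ Finset.range (K + 1),
              ((2 * (Fintype.card n : ℝ) * ((P.L : ℝ) ^ 2 + 6 * (((P.d + 2) * P.L : ℕ) : ℝ) ^ 2) ^ 2 + 2 / α) *
                (((2 * ((P.d + 3) * P.L + 2) + 1) ^ P.d * P.d ^ 2 : ℕ) : ℝ)) ^ k * t k) *
              ∑ q ∈ Z, (1 - reTr (GaugeField.plaqHol U q)) := by
  classical
  set A : ℝ := 2 * (Fintype.card n : ℝ) * ((P.L : ℝ) ^ 2 + 6 * (((P.d + 2) * P.L : ℕ) : ℝ) ^ 2) ^ 2 + 2 / α with hA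
  set Mn : ℕ := (2 * ((P.d + 3) * P.L + 2) + 1) ^ P.d * P.d ^ 2 with hMn
  have hA0 : 0 ≤ A := by positivity
  have hM0 : (0 : ℝ) ≤ (Mn : ℝ) := Nat.cast_nonneg _
  have hE0 : ∀ (k : ℕ) (V : GaugeField P k (Matrix.specialUnitaryGroup n ℂ)) (p : Plaq P k),
      0 ≤ 1 - reTr (GaugeField.plaqHol V p) := fun k V p => sub_nonneg.mpr (GaugeGroup.reTr_le_one _)
  intro K
  induction K with
  | zero =>
      intro _ Y
      refine ⟨Y 0, ?_, ?_⟩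
      · simp
      · intro t _ U
        simp only [zero_add, Finset.sum_range_one, pow_zero, one_mul]
        exact le_rfl
  | succ K ih =>
      intro hK Y
      set R : Plaq P (K + 1) → Finset (Plaq P K) := fun p => boxRegion (emb p.src) ((P.d + 3) * P.L + 2) with hR
      set X : Finset (Plaq P K) := (Y (K + 1)).biUnion R with hX
      set Y' : (k : ℕ) → Finset (Plaq P k) := Function.update Y K (Y K ∪ X) with hY'
      obtain ⟨Z, hZc, hZ⟩ := ih (Nat.le_of_succ_le hK) Y'
      have hY'K : Y' K = Y K ∪ X := by rw [hY', Function.update_self]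
      have hY'lt : ∀ k ∈ Finset.range K, Y' k = Y k := fun k hk => by
        rw [hY', Function.update_of_ne (Nat.ne_of_lt (Finset.mem_range.mp hk))]
      have hXc : (X.card : ℝ) ≤ (Mn : ℝ) * (Y (K + 1)).card := by
        have h := card_biUnion_le_mul (Y (K + 1)) R Mn fun p _ => by
          have := card_boxRegion_le (emb p.src) ((P.d + 3) * P.L + 2)
          rwa [← hMn] at this
        exact_mod_cast h
      refine ⟨Z, ?_, ?_⟩
      · -- cardinality of the level-0 region
        have hunion : ((Y K ∪ X).card : ℝ) ≤ (Y K).card + (Mn : ℝ) * (Y (K + 1)).card := by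
          calc ((Y K ∪ X).card : ℝ) ≤ (Y K).card + X.card := by exact_mod_cast Finset.card_union_le _ _
            _ ≤ (Y K).card + (Mn : ℝ) * (Y (K + 1)).card := by linarith
        calc (Z.card : ℝ) ≤ ∑ k ∈ Finset.range (K + 1), (Mn : ℝ) ^ k * (Y' k).card := hZc
          _ = ∑ k ∈ Finset.range K, (Mn : ℝ) ^ k * (Y k).card + (Mn : ℝ) ^ K * ((Y K ∪ X).card : ℝ) := by
              rw [Finset.sum_range_succ, hY'K]
              congr 1
              exact Finset.sum_congr rfl fun k hk => by rw [hY'lt k hk]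
          _ ≤ ∑ k ∈ Finset.range K, (Mn : ℝ) ^ k * (Y k).card +
                (Mn : ℝ) ^ K * ((Y K).card + (Mn : ℝ) * (Y (K + 1)).card) := by
              gcongr
          _ = ∑ k ∈ Finset.range (K + 1 + 1), (Mn : ℝ) ^ k * (Y k).card := by
              rw [Finset.sum_range_succ, Finset.sum_range_succ, pow_succ]
              ring
      · -- domination
        intro t ht U
        set t' : ℕ → ℝ := Function.update t K (t K + A * Mn * t (K + 1)) with ht'
        have ht'K : t' K = t K + A * Mn * t (K + 1) := by rw [ht', Function.update_self]
        have ht'lt : ∀ k ∈ Finset.range K, t' k = t k := fun k hk => by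
          rw [ht', Function.update_of_ne (Nat.ne_of_lt (Finset.mem_range.mp hk))]
        have ht'0 : ∀ k, 0 ≤ t' k := by
          intro k
          by_cases hk : k = K
          · subst hk
            rw [ht'K]
            have h1 := ht k
            have h2 := ht (k + 1)
            positivity
          · rw [ht', Function.update_of_ne hk]
            exact ht k
        have hdom := hZ t' ht'0 U
        -- the top level through the summed letter: `Ū^{K+1} = avgFun (Ū^K)`
        have htop := sum_one_sub_reTr_plaqHol_avgFun_le (n := n) hK hα hguard
          (Averaging.iter (fun _ => blockAvg (expMeanLogSU (n := n))) K U) (Y (K + 1))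
        rw [← hA, ← hX] at htop
        have hiter : ∀ p : Plaq P (K + 1),
            1 - reTr (GaugeField.plaqHol (Averaging.iter (P := P) (fun _ => blockAvg (expMeanLogSU (n := n))) (K + 1) U) p) =
              1 - reTr (GaugeField.plaqHol (avgFun (expMeanLogSU (n := n))
                (Averaging.iter (P := P) (fun _ => blockAvg (expMeanLogSU (n := n))) K U)) p) := fun p => rfl
        -- the merging step at level `K`
        have hmerge :
            t K * ∑ p ∈ Y K, (1 - reTr (GaugeField.plaqHol
                (Averaging.iter (fun _ => blockAvg (expMeanLogSU (n := n))) K U) p)) +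
              t (K + 1) * ∑ p ∈ Y (K + 1), (1 - reTr (GaugeField.plaqHol
                (Averaging.iter (fun _ => blockAvg (expMeanLogSU (n := n))) (K + 1) U) p)) ≤
            t' K * ∑ p ∈ Y' K, (1 - reTr (GaugeField.plaqHol
                (Averaging.iter (fun _ => blockAvg (expMeanLogSU (n := n))) K U) p)) := by
          rw [ht'K, hY'K, add_mul]
          apply add_le_add
          · exact mul_le_mul_of_nonneg_left
              (Finset.sum_le_sum_of_subset_of_nonneg Finset.subset_union_left fun q _ _ => hE0 K _ q) (ht K)
          · rw [Finset.sum_congr rfl fun p _ => hiter p]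
            calc t (K + 1) * ∑ p ∈ Y (K + 1), (1 - reTr (GaugeField.plaqHol (avgFun (expMeanLogSU (n := n))
                    (Averaging.iter (P := P) (fun _ => blockAvg (expMeanLogSU (n := n))) K U)) p))
                ≤ t (K + 1) * (A * Mn * ∑ q ∈ X, (1 - reTr (GaugeField.plaqHol
                    (Averaging.iter (fun _ => blockAvg (expMeanLogSU (n := n))) K U) q))) :=
                  mul_le_mul_of_nonneg_left htop (ht _)
              _ = A * Mn * t (K + 1) * ∑ q ∈ X, (1 - reTr (GaugeField.plaqHol
                    (Averaging.iter (fun _ => blockAvg (expMeanLogSU (n := n))) K U) q)) := by ring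
              _ ≤ A * Mn * t (K + 1) * ∑ q ∈ Y K ∪ X, (1 - reTr (GaugeField.plaqHol
                    (Averaging.iter (fun _ => blockAvg (expMeanLogSU (n := n))) K U) q)) :=
                  mul_le_mul_of_nonneg_left
                    (Finset.sum_le_sum_of_subset_of_nonneg Finset.subset_union_right fun q _ _ => hE0 K _ q)
                    (by have := ht (K + 1); positivity)
        -- the tilt bookkeeping
        have htilt : ∑ k ∈ Finset.range (K + 1), (A * Mn) ^ k * t' k = ∑ k ∈ Finset.range (K + 1 + 1), (A * Mn) ^ k * t k := by
          have hs : ∑ k ∈ Finset.range K, (A * Mn) ^ k * t' k = ∑ k ∈ Finset.range K, (A * Mn) ^ k * t k :=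
            Finset.sum_congr rfl fun k hk => by rw [ht'lt k hk]
          rw [Finset.sum_range_succ, hs, ht'K, Finset.sum_range_succ, Finset.sum_range_succ, pow_succ]
          ring
        -- assemble
        calc ∑ k ∈ Finset.range (K + 1 + 1), t k * ∑ p ∈ Y k, (1 - reTr (GaugeField.plaqHol
                (Averaging.iter (fun _ => blockAvg (expMeanLogSU (n := n))) k U) p))
            = ∑ k ∈ Finset.range K, t k * ∑ p ∈ Y k, (1 - reTr (GaugeField.plaqHol
                  (Averaging.iter (fun _ => blockAvg (expMeanLogSU (n := n))) k U) p)) +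
              (t K * ∑ p ∈ Y K, (1 - reTr (GaugeField.plaqHol
                  (Averaging.iter (fun _ => blockAvg (expMeanLogSU (n := n))) K U) p)) +
                t (K + 1) * ∑ p ∈ Y (K + 1), (1 - reTr (GaugeField.plaqHol
                  (Averaging.iter (fun _ => blockAvg (expMeanLogSU (n := n))) (K + 1) U) p))) := by
              rw [Finset.sum_range_succ, Finset.sum_range_succ, add_assoc]
          _ ≤ ∑ k ∈ Finset.range K, t' k * ∑ p ∈ Y' k, (1 - reTr (GaugeField.plaqHol
                  (Averaging.iter (fun _ => blockAvg (expMeanLogSU (n := n))) k U) p)) +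
              t' K * ∑ p ∈ Y' K, (1 - reTr (GaugeField.plaqHol
                  (Averaging.iter (fun _ => blockAvg (expMeanLogSU (n := n))) K U) p)) := by
              refine add_le_add (le_of_eq (Finset.sum_congr rfl fun k hk => ?_)) hmerge
              rw [ht'lt k hk, hY'lt k hk]
          _ = ∑ k ∈ Finset.range (K + 1), t' k * ∑ p ∈ Y' k, (1 - reTr (GaugeField.plaqHol
                  (Averaging.iter (fun _ => blockAvg (expMeanLogSU (n := n))) k U) p)) := by
              rw [Finset.sum_range_succ]
          _ ≤ (∑ k ∈ Finset.range (K + 1), (A * Mn) ^ k * t' k) * ∑ q ∈ Z, (1 - reTr (GaugeField.plaqHol U q)) := hdom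
          _ = (∑ k ∈ Finset.range (K + 1 + 1), (A * Mn) ^ k * t k) * ∑ q ∈ Z, (1 - reTr (GaugeField.plaqHol U q)) := by
              rw [htilt]

end Domination

/-! ## §2 The joint multiscale exponential plaquette moment under the level-0 state -/

section Moment

/-- The multiscale tilt functional `U ↦ Σ_{k≤K} t_k·Σ_{p∈Y_k}(1 − reTr Ū^k(∂p))` is measurable. [folklore] -/
theorem measurable_levelsTilt {N : ℕ} [NeZero N] (P : Params) (K : ℕ) (Y : (k : ℕ) → Finset (Plaq P k)) (t : ℕ → ℝ) :
    Measurable fun U : GaugeField P 0 (Matrix.specialUnitaryGroup (Fin N) ℂ) =>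
      ∑ k ∈ Finset.range (K + 1), t k * ∑ p ∈ Y k, (1 - reTr (GaugeField.plaqHol
        (Averaging.iter (fun _ => blockAvg (expMeanLogSU (n := Fin N))) k U) p)) := by
  refine Finset.measurable_sum _ fun k _ => Measurable.const_mul ?_ _
  refine Finset.measurable_sum _ fun p _ => measurable_const.sub ?_
  exact RegularGaugeGroup.measurable_reTr.comp ((Missing.measurable_plaqHol p).comp (measurable_iterBlockAvg P k))

/-- … with values in `[0, 2·Σ_{k≤K} t_k·#Y_k]` for `t ≥ 0`. [folklore] -/
theorem levelsTilt_mem_Icc {N : ℕ} [NeZero N] (P : Params) (K : ℕ) (Y : (k : ℕ) → Finset (Plaq P k)) {t : ℕ → ℝ}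
    (ht : ∀ k, 0 ≤ t k) (U : GaugeField P 0 (Matrix.specialUnitaryGroup (Fin N) ℂ)) :
    0 ≤ ∑ k ∈ Finset.range (K + 1), t k * ∑ p ∈ Y k, (1 - reTr (GaugeField.plaqHol
        (Averaging.iter (fun _ => blockAvg (expMeanLogSU (n := Fin N))) k U) p)) ∧
    ∑ k ∈ Finset.range (K + 1), t k * ∑ p ∈ Y k, (1 - reTr (GaugeField.plaqHol
        (Averaging.iter (fun _ => blockAvg (expMeanLogSU (n := Fin N))) k U) p)) ≤
      ∑ k ∈ Finset.range (K + 1), t k * (2 * (Y k).card) := by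
  have h0 : ∀ (k : ℕ) (p : Plaq P k), 0 ≤ 1 - reTr (GaugeField.plaqHol
      (Averaging.iter (P := P) (fun _ => blockAvg (expMeanLogSU (n := Fin N))) k U) p) :=
    fun k p => (RegularGaugeGroup.one_sub_reTr_mem_Icc _).1
  have h2 : ∀ (k : ℕ) (p : Plaq P k), 1 - reTr (GaugeField.plaqHol
      (Averaging.iter (P := P) (fun _ => blockAvg (expMeanLogSU (n := Fin N))) k U) p) ≤ 2 :=
    fun k p => (RegularGaugeGroup.one_sub_reTr_mem_Icc _).2
  refine ⟨Finset.sum_nonneg fun k _ => mul_nonneg (ht k) (Finset.sum_nonneg fun p _ => h0 k p),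
    Finset.sum_le_sum fun k _ => mul_le_mul_of_nonneg_left ?_ (ht k)⟩
  calc ∑ p ∈ Y k, (1 - reTr (GaugeField.plaqHol
        (Averaging.iter (P := P) (fun _ => blockAvg (expMeanLogSU (n := Fin N))) k U) p)) ≤ ∑ _p ∈ Y k, (2 : ℝ) :=
        Finset.sum_le_sum fun p _ => h2 k p
    _ = 2 * (Y k).card := by rw [Finset.sum_const, nsmul_eq_mul]; ring

/-- The exponential of the multiscale tilt functional is integrable under the level-0 state (`β ≥ 0`, `t ≥ 0`). [folklore] -/
theorem integrable_exp_levelsTilt {N : ℕ} [NeZero N] (P : Params) {β : ℝ} (hβ : 0 ≤ β) (K : ℕ) (Y : (k : ℕ) → Finset (Plaq P k))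
    {t : ℕ → ℝ} (ht : ∀ k, 0 ≤ t k) :
    Integrable (fun U : GaugeField P 0 (Matrix.specialUnitaryGroup (Fin N) ℂ) =>
        Real.exp (β * ∑ k ∈ Finset.range (K + 1), t k * ∑ p ∈ Y k, (1 - reTr (GaugeField.plaqHol
          (Averaging.iter (fun _ => blockAvg (expMeanLogSU (n := Fin N))) k U) p))))
      (T4GenFunBounds.gibbsMeasure P β : Measure (GaugeField P 0 (Matrix.specialUnitaryGroup (Fin N) ℂ))) := by
  haveI := T4GenFunBounds.isProbabilityMeasure_gibbsMeasure (G := Matrix.specialUnitaryGroup (Fin N) ℂ) P hβ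
  refine (integrable_const (Real.exp (β * ∑ k ∈ Finset.range (K + 1), t k * (2 * (Y k).card)))).mono'
    (Real.measurable_exp.comp ((measurable_levelsTilt P K Y t).const_mul β)).aestronglyMeasurable
    (ae_of_all _ fun U => ?_)
  rw [Real.norm_eq_abs, Real.abs_exp]
  exact Real.exp_le_exp.2 (mul_le_mul_of_nonneg_left (levelsTilt_mem_Icc P K Y ht U).2 hβ)

/-- ★★ **THE JOINT MULTISCALE EXPONENTIAL PLAQUETTE MOMENT.**  For every `N ≥ 1` and `L` there are `G > 0`, `V ≥ 1`, `C ≥ 0` (functions of `N`, `L`: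
`G = A·M`, `V = M`, `C` = n20-c's rung-0 constant) such that for every `d = 4` parameter set `P` with `P.L = L`, every `K ≤ m + K_P`, every `β ≥ 4N`,
every level-indexed family `Y_k ⊆ Plaq P k` and every tilt `t ≥ 0` in the BUDGET `Σ_{k≤K} G^k·t_k ≤ 1∕12`,
  `∫ exp(β·Σ_{k≤K} t_k·Σ_{p∈Y_k}(1 − reTr Ū^k(∂p))) d(gibbsMeasure P β) ≤ exp(C·(Σ_{k≤K} G^k t_k)·(Σ_{k≤K} V^k #Y_k))`
— all levels at once (§1's domination to ONE level-0 carrier with tilt `Σ_k G^k t_k ≤ 1∕12` on `≤ Σ_k V^k #Y_k` plaquettes, then rung 0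
`localExpMoment_gibbsMeasure` once). [folklore] -/
theorem jointExpMoment_levels (N : ℕ) [NeZero N] (L : ℕ) :
    ∃ G : ℝ, 0 < G ∧ ∃ V : ℝ, 1 ≤ V ∧ ∃ C : ℝ, 0 ≤ C ∧ ∀ (P : Params), P.d = 4 → P.L = L → ∀ (K : ℕ), K ≤ P.m + P.K →
      ∀ (β : ℝ), 4 * N ≤ β → ∀ (Y : (k : ℕ) → Finset (Plaq P k)) (t : ℕ → ℝ), (∀ k, 0 ≤ t k) →
        ∑ k ∈ Finset.range (K + 1), G ^ k * t k ≤ 1 / 12 →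
        ∫ U, Real.exp (β * ∑ k ∈ Finset.range (K + 1), t k * ∑ p ∈ Y k, (1 - reTr (GaugeField.plaqHol
              (Averaging.iter (fun _ => blockAvg (expMeanLogSU (n := Fin N))) k U) p)))
            ∂(T4GenFunBounds.gibbsMeasure P β : Measure (GaugeField P 0 (Matrix.specialUnitaryGroup (Fin N) ℂ))) ≤
          Real.exp (C * (∑ k ∈ Finset.range (K + 1), G ^ k * t k) * ∑ k ∈ Finset.range (K + 1), V ^ k * (Y k).card) := by
  obtain ⟨C₀, hC₀, h0⟩ := localExpMoment_gibbsMeasure N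
  -- the letters (functions of `N`, `L` only)
  set Nr : ℝ := (Fintype.card (Fin N) : ℝ) with hNr
  set κ : ℝ := ((((4 + 2) * L : ℕ) : ℝ) ^ 2 / 4) with hκ
  set CL : ℝ := (L : ℝ) ^ 2 + 6 * (((4 + 2) * L : ℕ) : ℝ) ^ 2 with hCL
  set α : ℝ := (deltaSU (Fin N) / (2 * (κ + 1))) ^ 2 / (2 * Nr) with hαdef
  set A : ℝ := 2 * Nr * CL ^ 2 + 2 / α with hA
  set Mn : ℕ := (2 * ((4 + 3) * L + 2) + 1) ^ 4 * 4 ^ 2 with hMn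
  have hNr0 : 0 < Nr := by rw [hNr]; exact_mod_cast Fintype.card_pos
  have hκ0 : 0 ≤ κ := by positivity
  have hδN := deltaSU_pos (n := Fin N)
  have hα0 : 0 < α := by positivity
  have hA0 : 0 < A := by positivity
  have hMpos : 0 < Mn := by positivity
  have hM1 : (1 : ℝ) ≤ (Mn : ℝ) := by exact_mod_cast hMpos
  have hM0 : (0 : ℝ) < (Mn : ℝ) := by exact_mod_cast hMpos
  have hsqrt : Real.sqrt (2 * Nr * α) = deltaSU (Fin N) / (2 * (κ + 1)) := by
    rw [hαdef, mul_div_cancel₀ _ (by positivity : (2 : ℝ) * Nr ≠ 0)]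
    exact Real.sqrt_sq (by positivity)
  have hguard : κ * Real.sqrt (2 * Nr * α) < deltaSU (Fin N) := by
    rw [hsqrt]
    have h1 : κ / (2 * (κ + 1)) < 1 := by
      rw [div_lt_one (by positivity)]; linarith
    calc κ * (deltaSU (Fin N) / (2 * (κ + 1))) = deltaSU (Fin N) * (κ / (2 * (κ + 1))) := by ring
      _ < deltaSU (Fin N) * 1 := mul_lt_mul_of_pos_left h1 hδN
      _ = deltaSU (Fin N) := mul_one _
  refine ⟨A * Mn, by positivity, (Mn : ℝ), hM1, C₀, hC₀, ?_⟩
  intro P hd hL K hK β hβ Y t ht hbudget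
  have hNpos : (0 : ℝ) < N := Nat.cast_pos.mpr (Nat.pos_of_ne_zero (NeZero.ne N))
  have hβ0 : 0 ≤ β := le_trans (by positivity) hβ
  have hdL1 : ((P.d + 2) * P.L : ℕ) = (4 + 2) * L := by rw [hd, hL]
  have hdL2 : (2 * ((P.d + 3) * P.L + 2) + 1) ^ P.d * P.d ^ 2 = Mn := by rw [hd, hL]
  have hPL : (P.L : ℝ) = (L : ℝ) := by rw [hL]
  have hguardP : ((((P.d + 2) * P.L : ℕ) : ℝ) ^ 2 / 4) * Real.sqrt (2 * (Fintype.card (Fin N) : ℝ) * α) < deltaSU (Fin N) := by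
    rw [hdL1]; exact hguard
  -- §1 at `P`
  obtain ⟨Z, hZc, hZ⟩ := sum_levels_tilt_le_levelZero (n := Fin N) (P := P) hα0 hguardP K hK Y
  rw [hdL2] at hZc
  have hZ' := hZ t ht
  rw [hdL1, hdL2, hPL, ← hNr, ← hCL, ← hA] at hZ'
  -- the level-0 tilt and the volume
  set a : ℝ := ∑ k ∈ Finset.range (K + 1), (A * Mn) ^ k * t k with ha
  set vol : ℝ := ∑ k ∈ Finset.range (K + 1), (Mn : ℝ) ^ k * (Y k).card with hvol
  have ha0 : 0 ≤ a := Finset.sum_nonneg fun k _ => mul_nonneg (pow_nonneg (by positivity) _) (ht k)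
  have ha12 : a ≤ 1 / 12 := hbudget
  have hvol0 : 0 ≤ vol := Finset.sum_nonneg fun k _ => mul_nonneg (pow_nonneg hM0.le _) (Nat.cast_nonneg _)
  haveI := T4GenFunBounds.isProbabilityMeasure_gibbsMeasure (G := Matrix.specialUnitaryGroup (Fin N) ℂ) P hβ0
  -- the dominating level-0 carrier is integrable
  have hg_int : Integrable (fun U : GaugeField P 0 (Matrix.specialUnitaryGroup (Fin N) ℂ) =>
      Real.exp (a * β * ∑ q ∈ Z, (1 - reTr (GaugeField.plaqHol U q))))
      (T4GenFunBounds.gibbsMeasure P β : Measure (GaugeField P 0 (Matrix.specialUnitaryGroup (Fin N) ℂ))) :=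
    integrable_exp_plaqSum_iter P hβ0 0 (a * β) Z
  have hmono : ∫ U, Real.exp (β * ∑ k ∈ Finset.range (K + 1), t k * ∑ p ∈ Y k, (1 - reTr (GaugeField.plaqHol
          (Averaging.iter (fun _ => blockAvg (expMeanLogSU (n := Fin N))) k U) p)))
        ∂(T4GenFunBounds.gibbsMeasure P β : Measure (GaugeField P 0 (Matrix.specialUnitaryGroup (Fin N) ℂ))) ≤
      ∫ U, Real.exp (a * β * ∑ q ∈ Z, (1 - reTr (GaugeField.plaqHol U q)))
        ∂(T4GenFunBounds.gibbsMeasure P β : Measure (GaugeField P 0 (Matrix.specialUnitaryGroup (Fin N) ℂ))) := by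
    refine integral_mono_of_nonneg (ae_of_all _ fun U => (Real.exp_pos _).le) hg_int (ae_of_all _ fun U => ?_)
    refine Real.exp_le_exp.mpr ?_
    calc β * ∑ k ∈ Finset.range (K + 1), t k * ∑ p ∈ Y k, (1 - reTr (GaugeField.plaqHol
            (Averaging.iter (fun _ => blockAvg (expMeanLogSU (n := Fin N))) k U) p))
        ≤ β * (a * ∑ q ∈ Z, (1 - reTr (GaugeField.plaqHol U q))) := mul_le_mul_of_nonneg_left (hZ' U) hβ0
      _ = a * β * ∑ q ∈ Z, (1 - reTr (GaugeField.plaqHol U q)) := by ring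
  have hrung := h0 P hd β hβ a ha0 ha12 Z
  calc ∫ U, Real.exp (β * ∑ k ∈ Finset.range (K + 1), t k * ∑ p ∈ Y k, (1 - reTr (GaugeField.plaqHol
          (Averaging.iter (fun _ => blockAvg (expMeanLogSU (n := Fin N))) k U) p)))
        ∂(T4GenFunBounds.gibbsMeasure P β : Measure (GaugeField P 0 (Matrix.specialUnitaryGroup (Fin N) ℂ)))
      ≤ ∫ U, Real.exp (a * β * ∑ q ∈ Z, (1 - reTr (GaugeField.plaqHol U q)))
          ∂(T4GenFunBounds.gibbsMeasure P β : Measure (GaugeField P 0 (Matrix.specialUnitaryGroup (Fin N) ℂ))) := hmono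
    _ ≤ Real.exp (C₀ * a * Z.card) := hrung
    _ ≤ Real.exp (C₀ * a * vol) := Real.exp_le_exp.mpr (mul_le_mul_of_nonneg_left hZc (by positivity))

end Moment

end Summit.QuantumFields.YangMills.BalabanUVNodes.N20ByValueMultiscaleTilt

end

/-! ## Erratum to the header prose (v1.1, append-only; no declaration changed)

The header's sentence «The located wall of NE7b in the fourth currency is therefore EXACTLY the LEVEL-UNIFORMITY of the letters (`G`, `V` …) — … — and
NOT a statement about independence of large-field events across scales» is TOO STRONG and is withdrawn; module 14
(`…Theorems.BalabanUVNodesN20ByValueMultiscaleCells`) carries the corrected reading, repeated here.  Along this road the canonical rates of module 13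
(`τ_k = G^{−k}∕(12(k+1)(k+2))`) decay for TWO separate reasons: the crude domination LETTERS (`G^{−k}`: a worst-case bound, no cancellation inside the block
averages) AND the single joint tilt budget of `jointExpMoment_levels` (every level is charged to the SAME level-0 carrier and to ONE rung-0 chessboard bound,
so the tilts must be summable over the levels — whence the weights `1∕((k+1)(k+2))`).  Level-uniform letters alone would still leave summable, not uniform,
rates.  A level-UNIFORM multiscale rate — what a summable `W_K` is counted from — calls (along the exponential-moment road) for a joint exponential moment
with a PER-LEVEL budget, factorising scale by scale (`∫exp(β·Σ_k t_k X_k) dμ_β ≤ Π_k e^{c·t_k·#Y_k}` for `t_k ≤ a₀` EACH), i.e. a quasi-independence of the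
fluctuation fields across block-averaging scales, together with running-coupling-only one-level constants: both are outputs of Bałaban's inductive
small-field analysis (print's KIND [Balaban1989LargeFieldII] (1.79) p. 383), and generation 6's caution (b′) STANDS for the UNIFORM product.  What modules
12–14 do show, unconditionally: the product SHAPE — one Peierls factor per pinned plaquette ∕ cell of every level, rates independent of the number of
pinned levels — is elementary by value. -/
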